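import Literature.Probability.LatticeModels.CoarseCellHyperDefects
import Literature.Probability.LatticeModels.CoarseCellMixingCounting
import Literature.Probability.LatticeModels.CoarseCellMixingDefectsClusters
import HarnessLib

/-!
# Coarse cells with hyperedge defects, II: general joint volumes, frozen marks, defect objects

Second definitions file of the two-species (cells + marks) vocabulary begun in
`CoarseCellHyperDefects.lean`. The Dobrushin–Shlosman / van den Berg–Maes block recursion with a
second, Kotecký–Preiss-rare defect species (ACTIVE MARKS = hyperedges gluing the cells of a
TERRITORY) cannot be run on the joint volumes `hvol terr A` alone: its chain rule freezes the marks
of a volume one at a time (a frozen mark stays INACTIVE, or the observable vanishes), so the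
recursion lives on GENERAL JOINT VOLUMES — finite site sets that are cell-saturated in the ordinary
sites and contain the ordinary sites of the territories of their marks (`IsHVol`) — with exteriors
whose frozen marks meeting the volume are inactive (`NoFrozenAct`). This file fixes that vocabulary
and the hypotheses of the two-species engine in it:

* `tdiam`, `tspan` — the coarse diameter of a territory and its SPAN `|T| + diam T` (the
  Kotecký–Preiss weight of a mark must charge the span: a mark with a two-cell territory at coarse
  distance `L` transports influence over distance `L` at the price of one object);
* `IsHVol`, `VolCell`, `NoFrozenAct`, `HyperAdm` (admissible boundary pairs relative to a source
  region `F`: frozen ordinary sites off `F` agree and are good, frozen marks whose territory is not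
  inside `F` are inactive in both — no agreement of inactive marks is asked);
* `ActDependsOn` — dependence on a set of sites and on the ACTIVITY STATUS of another (marks are
  read only through "active or not");
* `IsHyperMarkovV` — exact locality of the kernels of general joint volumes: two exteriors give the
  same kernel expectation when they agree on the ordinary sites within coarse distance `1` of the
  volume's territories, have the same ACTIVITY PATTERN on the frozen marks meeting the volume, and
  agree on the active ones of these together with the ordinary sites of their territories (the
  values of inactive marks are never read);
* `IsGoodFSHyperV`, `HyperPeierlsV` — the good-exterior finite-size condition and the two-species
  kernel-uniform Peierls bound of `CoarseCellHyperDefects`, asked for general joint volumes and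
  exteriors without active frozen marks;
* `HObj`, `body`, `HAdj`, `IsDefect`, `defectCluster` — the DEFECT OBJECTS of the expansion (cells,
  with body `{c}`, defective when bad; sites, with body their territory, defective when active),
  linked when their bodies come within coarse distance `1`, and the defect cluster attached to a
  seed (`seedClosure` of `CoarseCellMixingDefectsClusters` on objects).

Elementary closure facts (`IsHVol` is stable under restriction to the sites with territory in a
cell set, under removal of marks, under removal of a cell not in the territory of a volume mark;
the sites whose territory avoids a cell set form a volume) are proved here; the engine is in the
companion files `CoarseCellHyper*`.

Sources: R. L. Dobrushin, S. B. Shlosman (1985), §2; J. van den Berg, C. Maes, Ann. Probab. 22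
(1994); R. Kotecký, D. Preiss, CMP 103 (1986); H.-O. Georgii, *Gibbs Measures and Phase
Transitions* (2011), Ch. 8. The bookkeeping (general joint volumes, span weights) is folklore-level;
no theorem of the literature is claimed in this file.
-/

noncomputable section

open MeasureTheory
open scoped Classical

namespace Literature.Probability.LatticeModels

variable {d : ℕ} {μ : Fin d → ℕ} {V S : Type*}

/-! ### Diameter and span of a territory -/

/-- The coarse (`ℓ^∞` cyclic) diameter of a finite set of cells (`0` for the empty set and for
singletons). [folklore] -/
def tdiam (T : Finset (CoarseIdx μ)) : ℕ :=
  T.sup fun a => T.sup fun b => cdist a b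

/-- Two cells of `T` are within its diameter. [folklore] -/
theorem cdist_le_tdiam {T : Finset (CoarseIdx μ)} {a b : CoarseIdx μ} (ha : a ∈ T) (hb : b ∈ T) :
    cdist a b ≤ tdiam T :=
  le_trans (Finset.le_sup (f := fun b => cdist a b) hb)
    (Finset.le_sup (f := fun a => T.sup fun b => cdist a b) ha)

/-- The diameter is bounded by any common bound on the pairwise distances. [folklore] -/
theorem tdiam_le {T : Finset (CoarseIdx μ)} {m : ℕ} (h : ∀ a ∈ T, ∀ b ∈ T, cdist a b ≤ m) :
    tdiam T ≤ m :=
  Finset.sup_le fun a ha => Finset.sup_le fun b hb => h a ha b hb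

/-- A singleton has diameter `0`. [folklore] -/
@[simp] theorem tdiam_singleton (a : CoarseIdx μ) : tdiam ({a} : Finset (CoarseIdx μ)) = 0 := by
  simp [tdiam]

/-- The empty set has diameter `0`. [folklore] -/
@[simp] theorem tdiam_empty : tdiam (∅ : Finset (CoarseIdx μ)) = 0 := by
  simp [tdiam]

/-- The diameter is monotone. [folklore] -/
theorem tdiam_mono {T T' : Finset (CoarseIdx μ)} (h : T ⊆ T') : tdiam T ≤ tdiam T' :=
  tdiam_le fun _ ha _ hb => cdist_le_tdiam (h ha) (h hb)

/-- The **span** of a territory: number of cells plus coarse diameter — the exponent charged to a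
mark by the Kotecký–Preiss smallness condition of the two-species engine (entropy of the cells it
glues AND the distance it transports influence over). [cite: KoteckyPreiss1986, (1)] -/
def tspan (T : Finset (CoarseIdx μ)) : ℕ := T.card + tdiam T

/-- `|T| ≤ span T`. [folklore] -/
theorem card_le_tspan (T : Finset (CoarseIdx μ)) : T.card ≤ tspan T := Nat.le_add_right _ _

/-- `diam T ≤ span T`. [folklore] -/
theorem tdiam_le_tspan (T : Finset (CoarseIdx μ)) : tdiam T ≤ tspan T := Nat.le_add_left _ _

/-! ### General joint volumes -/

section Volumes

variable (cell : V → CoarseIdx μ) (terr : V → Finset (CoarseIdx μ)) (act : V → Set S)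

/-- **General joint volume**: a finite set of sites that is cell-saturated in the ORDINARY sites
(`act v = ∅`: with an ordinary site it contains every ordinary site of the same cell) and
TERRITORY-CLOSED (with a site it contains every ordinary site of the cells of its territory). The
joint volumes `hvol terr A` are of this form; so are the volumes met by the chain rule of the
two-species engine (marks frozen one at a time). [cite: DobrushinShlosman1985, §2] -/
structure IsHVol (Λ : Finset V) : Prop where
  /-- cell-saturation in the ordinary sites -/
  sat : ∀ v w, act v = ∅ → act w = ∅ → cell v = cell w → v ∈ Λ → w ∈ Λ
  /-- the ordinary sites of the territory of a volume site are volume sites -/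
  closed : ∀ v ∈ Λ, ∀ w, act w = ∅ → cell w ∈ terr v → w ∈ Λ

/-- **Volume cells** of `Λ`: the cells all of whose ordinary sites lie in `Λ` (cells without
ordinary sites count as volume cells of every volume, as in the one-species series). [folklore] -/
def VolCell (Λ : Finset V) (c : CoarseIdx μ) : Prop := ∀ w, act w = ∅ → cell w = c → w ∈ Λ

/-- **No active frozen mark meets the volume**: every site outside `Λ` whose territory contains the
cell of an ordinary site of `Λ` is inactive in `ζ`. [cite: BergMaes1994, §2] -/
def NoFrozenAct (Λ : Finset V) (ζ : V → S) : Prop :=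
  ∀ v, v ∉ Λ → (∃ w ∈ Λ, act w = ∅ ∧ cell w ∈ terr v) → ζ v ∉ act v

variable (good : CoarseIdx μ → Set (V → S))

/-- **Admissible boundary pairs relative to the source region `F`** (two-species form of
`AdmRegion`): off the volume, ordinary sites whose cell is not a source cell agree and are good in
both configurations, and sites whose territory is not inside `F` are inactive in both (inactive
frozen marks need not agree: the kernels never read their values, `IsHyperMarkovV`). [folklore] -/
def HyperAdm (F : Finset (CoarseIdx μ)) (Λ : Finset V) (ζ ζ' : V → S) : Prop :=
  (∀ v, v ∉ Λ → act v = ∅ → cell v ∉ F → ζ v = ζ' v ∧ ζ ∈ good (cell v) ∧ ζ' ∈ good (cell v)) ∧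
    ∀ v, v ∉ Λ → ¬ terr v ⊆ F → ζ v ∉ act v ∧ ζ' v ∉ act v

variable {cell terr act good}

/-- Admissibility is symmetric in the pair. [folklore] -/
theorem HyperAdm.symm {F : Finset (CoarseIdx μ)} {Λ : Finset V} {ζ ζ' : V → S}
    (h : HyperAdm cell terr act good F Λ ζ ζ') : HyperAdm cell terr act good F Λ ζ' ζ :=
  ⟨fun v hv ho hF => ⟨(h.1 v hv ho hF).1.symm, (h.1 v hv ho hF).2.2, (h.1 v hv ho hF).2.1⟩,
    fun v hv hF => ⟨(h.2 v hv hF).2, (h.2 v hv hF).1⟩⟩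

/-- Admissibility is monotone in the source region. [folklore] -/
theorem HyperAdm.mono {F F' : Finset (CoarseIdx μ)} (hFF' : F ⊆ F') {Λ : Finset V} {ζ ζ' : V → S}
    (h : HyperAdm cell terr act good F Λ ζ ζ') : HyperAdm cell terr act good F' Λ ζ ζ' :=
  ⟨fun v hv ho hF => h.1 v hv ho fun hvF => hF (hFF' hvF),
    fun v hv hF => h.2 v hv fun hsub => hF (hsub.trans hFF')⟩

/-- The cells of the territory of a volume site are volume cells. [folklore] -/
theorem IsHVol.volCell_of_mem_terr {Λ : Finset V} (hΛ : IsHVol cell terr act Λ) {v : V} (hv : v ∈ Λ)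
    {c : CoarseIdx μ} (hc : c ∈ terr v) : VolCell cell act Λ c :=
  fun w hw hwc => hΛ.closed v hv w hw (hwc ▸ hc)

/-- The cell of an ordinary volume site is a volume cell. [folklore] -/
theorem IsHVol.volCell_cell {Λ : Finset V} (hΛ : IsHVol cell terr act Λ) {v : V} (hv : v ∈ Λ)
    (hvo : act v = ∅) : VolCell cell act Λ (cell v) :=
  fun w hw hwc => hΛ.sat v w hvo hw hwc.symm hv

/-- **Restriction to a cell set**: the sites of a volume whose territory lies in `B` form a volume,
provided ordinary sites have singleton territories. [folklore] -/
theorem IsHVol.filter_terr_subset {Λ : Finset V} (hΛ : IsHVol cell terr act Λ)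
    (hord : ∀ v, act v = ∅ → terr v = {cell v}) (B : Finset (CoarseIdx μ)) :
    IsHVol cell terr act (Λ.filter fun v => terr v ⊆ B) := by
  refine ⟨fun v w hv hw hvw hvΛ => ?_, fun v hvΛ w hw hwc => ?_⟩
  · rw [Finset.mem_filter] at hvΛ ⊢
    refine ⟨hΛ.sat v w hv hw hvw hvΛ.1, ?_⟩
    rw [hord w hw, Finset.singleton_subset_iff, ← hvw]
    exact hvΛ.2 (by rw [hord v hv]; exact Finset.mem_singleton_self _)
  · rw [Finset.mem_filter] at hvΛ ⊢
    refine ⟨hΛ.closed v hvΛ.1 w hw hwc, ?_⟩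
    rw [hord w hw, Finset.singleton_subset_iff]
    exact hvΛ.2 hwc

/-- **Removing marks**: erasing any set of non-ordinary sites from a volume leaves a volume.
[folklore] -/
theorem IsHVol.sdiff_marks {Λ : Finset V} (hΛ : IsHVol cell terr act Λ) (M : Finset V)
    (hM : ∀ v ∈ M, act v ≠ ∅) : IsHVol cell terr act (Λ \ M) := by
  refine ⟨fun v w hv hw hvw hvΛ => ?_, fun v hvΛ w hw hwc => ?_⟩
  · rw [Finset.mem_sdiff] at hvΛ ⊢
    exact ⟨hΛ.sat v w hv hw hvw hvΛ.1, fun hwM => hM w hwM hw⟩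
  · rw [Finset.mem_sdiff] at hvΛ ⊢
    exact ⟨hΛ.closed v hvΛ.1 w hw hwc, fun hwM => hM w hwM hw⟩

/-- **Removing a cell**: erasing the ordinary sites of a cell `y` from a volume leaves a volume,
provided no remaining site has `y` in its territory (all marks touching `y` were frozen first) and
ordinary sites have singleton territories. [folklore] -/
theorem IsHVol.removeCell {Λ : Finset V} (hΛ : IsHVol cell terr act Λ)
    (hord : ∀ v, act v = ∅ → terr v = {cell v}) (y : CoarseIdx μ)
    (hy : ∀ v ∈ Λ, act v ≠ ∅ → y ∉ terr v) :
    IsHVol cell terr act (Λ.filter fun v => ¬ (act v = ∅ ∧ cell v = y)) := by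
  refine ⟨fun v w hv hw hvw hvΛ => ?_, fun v hvΛ w hw hwc => ?_⟩
  · rw [Finset.mem_filter] at hvΛ ⊢
    refine ⟨hΛ.sat v w hv hw hvw hvΛ.1, fun h => hvΛ.2 ⟨hv, hvw.trans h.2⟩⟩
  · rw [Finset.mem_filter] at hvΛ ⊢
    refine ⟨hΛ.closed v hvΛ.1 w hw hwc, fun h => ?_⟩
    by_cases hvo : act v = ∅
    · rw [hord v hvo, Finset.mem_singleton] at hwc
      exact hvΛ.2 ⟨hvo, hwc ▸ h.2⟩
    · exact hy v hvΛ.1 hvo (h.2 ▸ hwc)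

/-- **The root volume**: the sites whose territory avoids the cell set `Δ` form a volume, provided
ordinary sites have singleton territories. [folklore] -/
theorem isHVol_filter_disjoint [Fintype V] (hord : ∀ v, act v = ∅ → terr v = {cell v})
    (Δ : Finset (CoarseIdx μ)) :
    IsHVol cell terr act (Finset.univ.filter fun v : V => ∀ c ∈ terr v, c ∉ Δ) := by
  refine ⟨fun v w hv hw hvw hvΛ => ?_, fun v hvΛ w hw hwc => ?_⟩
  · simp only [Finset.mem_filter, Finset.mem_univ, true_and] at hvΛ ⊢
    rw [hord w hw]
    intro c hc
    rw [Finset.mem_singleton] at hc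
    rw [hc, ← hvw]
    exact hvΛ (cell v) (by rw [hord v hv]; exact Finset.mem_singleton_self _)
  · simp only [Finset.mem_filter, Finset.mem_univ, true_and] at hvΛ ⊢
    rw [hord w hw]
    intro c hc
    rw [Finset.mem_singleton] at hc
    rw [hc]
    exact hvΛ _ hwc

/-- The joint volume `hvol terr A` of a cell set is a volume, provided ordinary sites have singleton
territories. [folklore] -/
theorem isHVol_hvol [Fintype V] (hord : ∀ v, act v = ∅ → terr v = {cell v})
    (A : Finset (CoarseIdx μ)) : IsHVol cell terr act (hvol terr A) := by
  refine ⟨fun v w hv hw hvw hvΛ => ?_, fun v hvΛ w hw hwc => ?_⟩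
  · rw [mem_hvol] at hvΛ ⊢
    rw [hord w hw, Finset.singleton_subset_iff, ← hvw]
    exact hvΛ (by rw [hord v hv]; exact Finset.mem_singleton_self _)
  · rw [mem_hvol] at hvΛ ⊢
    rw [hord w hw, Finset.singleton_subset_iff]
    exact hvΛ hwc

end Volumes

/-! ### Dependence through activity -/

/-- **Dependence on the sites `A` and on the ACTIVITY of the sites `P`**: `f σ = f τ` whenever
`σ, τ` agree on `A` and have the same activity status on `P` (observables of the two-species
expansion read marks only through "active or not"; `DependsOn f A` is the case `P = ∅`, see
`DependsOn.actDependsOn`). [folklore] -/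
def ActDependsOn (act : V → Set S) (f : (V → S) → ℝ) (A P : Set V) : Prop :=
  ∀ σ τ : V → S, (∀ v ∈ A, σ v = τ v) → (∀ v ∈ P, (σ v ∈ act v ↔ τ v ∈ act v)) → f σ = f τ

/-- Plain dependence on `A` is dependence on `A` through the activity of any `P`. [folklore] -/
theorem _root_.DependsOn.actDependsOn {act : V → Set S} {f : (V → S) → ℝ} {A : Set V}
    (h : DependsOn f A) (P : Set V) : ActDependsOn act f A P :=
  fun _ _ hA _ => h hA

/-- Dependence through activity is monotone in both index sets. [folklore] -/
theorem ActDependsOn.mono {act : V → Set S} {f : (V → S) → ℝ} {A A' P P' : Set V}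
    (h : ActDependsOn act f A P) (hA : A ⊆ A') (hP : P ⊆ P') : ActDependsOn act f A' P' :=
  fun σ τ hA' hP' => h σ τ (fun v hv => hA' v (hA hv)) fun v hv => hP' v (hP hv)

/-! ### The hypotheses of the two-species engine on general joint volumes -/

section Hypotheses

variable [MeasurableSpace S]

/-- **Hyper-Markov property on general joint volumes.** For every volume `Λ` and every two
exteriors `ζ, ζ'` which (a) agree on the ordinary sites off `Λ` whose cell is within coarse
distance `1` of the territory of a volume site, and (b) on every site off `Λ` whose territory
contains the cell of an ordinary volume site have the same activity status, and, when active, the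
same value and the same values on the ordinary sites (off `Λ`) of the cells of its territory, the
kernels `γ_Λ(· | ζ)`, `γ_Λ(· | ζ')` give the same expectation to every `[0,1]`-valued measurable
observable reading only `Λ` and agreeing sites, and the remaining sites only through an activity
status common to `ζ` and `ζ'` (exact locality of a finite-range interaction dressed by decoupled
hyperedges: an inactive hyperedge is absent from the interaction, whatever its value; an active one
couples the cells of its territory). [cite: Georgii2011, Ch. 8] -/
def IsHyperMarkovV [Fintype V] (cell : V → CoarseIdx μ) (terr : V → Finset (CoarseIdx μ))
    (act : V → Set S) (γ : Specification V S) : Prop :=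
  ∀ (Λ : Finset V), IsHVol cell terr act Λ → ∀ (ζ ζ' : V → S),
    (∀ v, v ∉ Λ → act v = ∅ → (∃ w ∈ Λ, ∃ c ∈ terr w, cdist c (cell v) ≤ 1) → ζ v = ζ' v) →
    (∀ v, v ∉ Λ → (∃ w ∈ Λ, act w = ∅ ∧ cell w ∈ terr v) →
      (ζ v ∈ act v ↔ ζ' v ∈ act v) ∧
        (ζ v ∈ act v → ζ v = ζ' v ∧ ∀ w, w ∉ Λ → act w = ∅ → cell w ∈ terr v → ζ w = ζ' w)) →
    ∀ f : (V → S) → ℝ, Measurable f → (∀ σ, 0 ≤ f σ ∧ f σ ≤ 1) →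
      ActDependsOn act f {v | v ∈ Λ ∨ ζ v = ζ' v} {v | (ζ v ∈ act v ↔ ζ' v ∈ act v)} →
      ∫ σ, f σ ∂(γ Λ ζ) = ∫ σ, f σ ∂(γ Λ ζ')

/-- **Good-exterior finite-size condition, general joint volumes** (window `n`, threshold `ε`):
`good c` is measurable and local in the ORDINARY sites of `c`; and for every cell `c`, every volume
`Λ` all of whose territories lie in the cube of `(4n+1)^d` cells centred at `c`, every two exteriors
that agree on the ordinary sites of the cube, are good on the cube-and-shell cells which are not
volume cells, and have no active frozen mark meeting the volume, the kernel expectations of every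
`[0,1]`-valued measurable observable of the ordinary sites of `c` differ by at most `ε`
(`IsGoodFS` when all sites are ordinary). [cite: DobrushinShlosman1985, §2] -/
structure IsGoodFSHyperV [Fintype V] (cell : V → CoarseIdx μ) (terr : V → Finset (CoarseIdx μ))
    (act : V → Set S) (γ : Specification V S) (good : CoarseIdx μ → Set (V → S)) (n : ℕ)
    (ε : ℝ) : Prop where
  /-- goodness of a cell reads only its ordinary sites -/
  good_local : ∀ (c : CoarseIdx μ) (σ τ : V → S),
    (∀ v, act v = ∅ → cell v = c → σ v = τ v) → (σ ∈ good c ↔ τ ∈ good c)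
  /-- goodness events are measurable -/
  good_meas : ∀ c, MeasurableSet (good c)
  /-- the finite-size condition for good exteriors without active frozen marks -/
  fs : ∀ (c : CoarseIdx μ) (Λ : Finset V), IsHVol cell terr act Λ →
    (∀ v ∈ Λ, ∀ a ∈ terr v, cdist c a ≤ 2 * n) →
    ∀ ζ ζ' : V → S, (∀ v, act v = ∅ → cdist c (cell v) ≤ 2 * n → ζ v = ζ' v) →
      (∀ c', cdist c c' ≤ 2 * n + 1 → ¬ VolCell cell act Λ c' → ζ ∈ good c' ∧ ζ' ∈ good c') →
      NoFrozenAct cell terr act Λ ζ → NoFrozenAct cell terr act Λ ζ' →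
      ∀ f : (V → S) → ℝ, Measurable f → (∀ σ, 0 ≤ f σ ∧ f σ ≤ 1) →
        DependsOn f {v | act v = ∅ ∧ cell v = c} →
        |∫ σ, f σ ∂(γ Λ ζ) - ∫ σ, f σ ∂(γ Λ ζ')| ≤ ε

/-- **Two-species kernel-uniform Peierls bound, general joint volumes**: for every volume `Λ`,
every exterior without active frozen mark meeting `Λ`, every cell set `D` each of whose
`cdist ≤ 1` neighbours is a volume cell or good in the exterior, and every `M ⊆ Λ`, the kernel
probability that all cells of `D` are bad AND all sites of `M` are active is at most
`q^{|D|} ∏_{v ∈ M} r_v`. [cite: Georgii2011, §6.2] -/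
def HyperPeierlsV [Fintype V] (cell : V → CoarseIdx μ) (terr : V → Finset (CoarseIdx μ))
    (act : V → Set S) (γ : Specification V S) (good : CoarseIdx μ → Set (V → S)) (q : ℝ)
    (r : V → ℝ) : Prop :=
  ∀ (Λ : Finset V), IsHVol cell terr act Λ → ∀ (ζ : V → S), NoFrozenAct cell terr act Λ ζ →
    ∀ (D : Finset (CoarseIdx μ)) (M : Finset V),
      (∀ c ∈ D, ∀ c' : CoarseIdx μ, cdist c c' ≤ 1 → VolCell cell act Λ c' ∨ ζ ∈ good c') →
      M ⊆ Λ →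
      γ Λ ζ ({σ | ∀ c ∈ D, σ ∉ good c} ∩ {σ | ∀ v ∈ M, σ v ∈ act v}) ≤
        ENNReal.ofReal (q ^ D.card * ∏ v ∈ M, r v)

end Hypotheses

/-! ### Defect objects -/

section Objects

/-- **Defect objects** of the two-species expansion: cells (`Sum.inl c`) and sites (`Sum.inr v`;
only the non-ordinary ones — the marks — are ever defective). [cite: BergMaes1994, §2] -/
abbrev HObj (μ : Fin d → ℕ) (V : Type*) : Type _ := CoarseIdx μ ⊕ V

variable (terr : V → Finset (CoarseIdx μ))

/-- The **body** of an object: the cell itself, or the territory of the site. [folklore] -/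
def body : HObj μ V → Finset (CoarseIdx μ) := Sum.elim (fun c => {c}) terr

/-- Bodies of cells. [folklore] -/
@[simp] theorem body_inl (c : CoarseIdx μ) : body terr (Sum.inl c : HObj μ V) = {c} := rfl

/-- Bodies of sites. [folklore] -/
@[simp] theorem body_inr (v : V) : body terr (Sum.inr v : HObj μ V) = terr v := rfl

/-- Two objects are **linked** when their bodies come within coarse distance `1`. [folklore] -/
def HAdj (o o' : HObj μ V) : Prop := ∃ a ∈ body terr o, ∃ b ∈ body terr o', cdist a b ≤ 1

variable {terr}

/-- The link relation is symmetric. [folklore] -/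
theorem HAdj.symm {o o' : HObj μ V} (h : HAdj terr o o') : HAdj terr o' o := by
  obtain ⟨a, ha, b, hb, hab⟩ := h
  exact ⟨b, hb, a, ha, by rwa [cdist_comm]⟩

/-- An object with non-empty body is linked to itself. [folklore] -/
theorem HAdj.refl_of_nonempty {o : HObj μ V} (h : (body terr o).Nonempty) : HAdj terr o o := by
  obtain ⟨a, ha⟩ := h
  exact ⟨a, ha, a, ha, by rw [cdist_self]; exact Nat.zero_le _⟩

/-- Two cells are linked iff they are within coarse distance `1`. [folklore] -/
theorem hAdj_inl_inl {c c' : CoarseIdx μ} :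
    HAdj terr (Sum.inl c : HObj μ V) (Sum.inl c') ↔ cdist c c' ≤ 1 := by
  simp [HAdj]

/-- A cell is linked to a site iff it is within coarse distance `1` of a cell of its territory.
[folklore] -/
theorem hAdj_inl_inr {c : CoarseIdx μ} {v : V} :
    HAdj terr (Sum.inl c : HObj μ V) (Sum.inr v) ↔ ∃ b ∈ terr v, cdist c b ≤ 1 := by
  simp [HAdj]

variable (good : CoarseIdx μ → Set (V → S)) (act : V → Set S)

/-- An object is **defective** in `σ`: a bad cell, or an active site. [cite: BergMaes1994, §2] -/
def IsDefect (σ : V → S) : HObj μ V → Prop :=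
  Sum.elim (fun c => σ ∉ good c) (fun v => σ v ∈ act v)

/-- A cell is defective iff it is bad. [folklore] -/
@[simp] theorem isDefect_inl (σ : V → S) (c : CoarseIdx μ) :
    IsDefect good act σ (Sum.inl c : HObj μ V) ↔ σ ∉ good c := Iff.rfl

/-- A site is defective iff it is active. [folklore] -/
@[simp] theorem isDefect_inr (σ : V → S) (v : V) :
    IsDefect good act σ (Sum.inr v : HObj μ V) ↔ σ v ∈ act v := Iff.rfl

variable (terr)

/-- **The defect cluster attached to the seed objects `Sd`** among the objects of the finite
universe `U`: the defective objects of `U` reachable from a defective seed object through linked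
defective objects of `U` (`seedClosure` on objects). [cite: BergMaes1994, §2] -/
def defectCluster (U Sd : Finset (HObj μ V)) (σ : V → S) : Finset (HObj μ V) :=
  seedClosure (HAdj terr) (U.filter fun o => IsDefect good act σ o) Sd

variable {terr good act}

/-- The defect cluster consists of defective objects of the universe. [folklore] -/
theorem defectCluster_subset (U Sd : Finset (HObj μ V)) (σ : V → S) :
    defectCluster terr good act U Sd σ ⊆ U.filter fun o => IsDefect good act σ o :=
  seedClosure_subset _ _

/-- The defect cluster is a cluster shape for its seed. [folklore] -/
theorem isClusterShape_defectCluster (U Sd : Finset (HObj μ V)) (σ : V → S) :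
    IsClusterShape (HAdj terr) Sd (defectCluster terr good act U Sd σ) :=
  isClusterShape_seedClosure _ _

/-- **The rectangle lemma for defect clusters**: for a cluster shape `K ⊆ U` of the seed `Sd`, the
defect cluster of `σ` is exactly `K` iff every object of `K` is defective and every object of `U`
outside `K` which is a seed object or linked to an object of `K` is sound. [folklore] -/
theorem defectCluster_eq_iff {U Sd K : Finset (HObj μ V)} (hK : IsClusterShape (HAdj terr) Sd K)
    (hKU : K ⊆ U) (σ : V → S) :
    defectCluster terr good act U Sd σ = K ↔
      (∀ o ∈ K, IsDefect good act σ o) ∧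
        ∀ o ∈ U, o ∉ K → (o ∈ Sd ∨ ∃ k ∈ K, HAdj terr k o) → ¬ IsDefect good act σ o := by
  rw [defectCluster, seedClosure_eq_iff hK]
  constructor
  · rintro ⟨hKB, hout⟩
    refine ⟨fun o ho => (Finset.mem_filter.1 (hKB ho)).2, fun o hoU hoK ho hdef => ?_⟩
    obtain ⟨hS, hadj⟩ := hout o (Finset.mem_filter.2 ⟨hoU, hdef⟩) hoK
    rcases ho with h | ⟨k, hk, hko⟩
    · exact hS h
    · exact hadj k hk hko
  · rintro ⟨hdef, hsound⟩
    refine ⟨fun o ho => Finset.mem_filter.2 ⟨hKU ho, hdef o ho⟩, fun o hoB hoK => ?_⟩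
    obtain ⟨hoU, hodef⟩ := Finset.mem_filter.1 hoB
    exact ⟨fun hoS => hsound o hoU hoK (Or.inl hoS) hodef,
      fun k hk hko => hsound o hoU hoK (Or.inr ⟨k, hk, hko⟩) hodef⟩

/-- The **weight** of an object at levels `q` (cells) and `r` (sites). [cite: KoteckyPreiss1986, (1)] -/
def objWeight (q : ℝ) (r : V → ℝ) : HObj μ V → ℝ := Sum.elim (fun _ => q) r

/-- Weight of a cell. [folklore] -/
@[simp] theorem objWeight_inl (q : ℝ) (r : V → ℝ) (c : CoarseIdx μ) :
    objWeight q r (Sum.inl c : HObj μ V) = q := rfl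

/-- Weight of a site. [folklore] -/
@[simp] theorem objWeight_inr (q : ℝ) (r : V → ℝ) (v : V) :
    objWeight (μ := μ) q r (Sum.inr v) = r v := rfl

/-- The **block** of a set of objects: the union of their bodies (the cells resampled with a
defect cluster). [folklore] -/
def objBlock (K : Finset (HObj μ V)) : Finset (CoarseIdx μ) := K.biUnion (body terr)

/-- Membership in the block of a set of objects. [folklore] -/
theorem mem_objBlock {K : Finset (HObj μ V)} {c : CoarseIdx μ} :
    c ∈ objBlock (terr := terr) K ↔ ∃ o ∈ K, c ∈ body terr o := by
  simp [objBlock]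

end Objects

/-! ### The Peierls bound with a LOCAL condition on active frozen marks -/

section PeierlsLocal

variable [MeasurableSpace S]

/-- **Two-species kernel-uniform Peierls bound, local form.** As `HyperPeierlsV`, but the exterior
may carry ACTIVE frozen marks provided their territories contain no volume cell within coarse
distance `1` of `D` (the Peierls estimate for the bad cells is local: it is transferred from the
reference system on the `1`-neighbourhood of `D` after the volume marks have been integrated out;
an active frozen hyperedge elsewhere is a fixed bounded tilt of the rest of the volume). This is
the form needed at the root of the expansion, where the frozen marks touching the conditioning
cells may be active. [cite: Georgii2011, §6.2] -/
def HyperPeierlsL [Fintype V] (cell : V → CoarseIdx μ) (terr : V → Finset (CoarseIdx μ))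
    (act : V → Set S) (γ : Specification V S) (good : CoarseIdx μ → Set (V → S)) (q : ℝ)
    (r : V → ℝ) : Prop :=
  ∀ (Λ : Finset V), IsHVol cell terr act Λ → ∀ (ζ : V → S),
    ∀ (D : Finset (CoarseIdx μ)) (M : Finset V),
      (∀ v, v ∉ Λ → ζ v ∈ act v → ∀ a ∈ terr v, (∃ c ∈ D, cdist c a ≤ 1) →
        ¬ VolCell cell act Λ a) →
      (∀ c ∈ D, ∀ c' : CoarseIdx μ, cdist c c' ≤ 1 → VolCell cell act Λ c' ∨ ζ ∈ good c') →
      M ⊆ Λ →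
      γ Λ ζ ({σ | ∀ c ∈ D, σ ∉ good c} ∩ {σ | ∀ v ∈ M, σ v ∈ act v}) ≤
        ENNReal.ofReal (q ^ D.card * ∏ v ∈ M, r v)

/-- The local form gives the global-exterior form `HyperPeierlsV` as soon as every cell carries an
ordinary site (under `NoFrozenAct` an active frozen site then meets no volume cell at all; cells
without ordinary sites are volume cells of every volume vacuously, which is the only obstruction).
[folklore] -/
theorem HyperPeierlsL.hyperPeierlsV [Fintype V] {cell : V → CoarseIdx μ}
    {terr : V → Finset (CoarseIdx μ)} {act : V → Set S} {γ : Specification V S}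
    {good : CoarseIdx μ → Set (V → S)} {q : ℝ} {r : V → ℝ}
    (h : HyperPeierlsL cell terr act γ good q r) (hinh : ∀ a : CoarseIdx μ, ∃ w, act w = ∅ ∧ cell w = a) :
    HyperPeierlsV cell terr act γ good q r := by
  intro Λ hΛ ζ hζ D M hD hM
  refine h Λ hΛ ζ D M (fun v hv hact a ha _ hvol => ?_) hD hM
  obtain ⟨w, hw, hwa⟩ := hinh a
  exact hζ v hv ⟨w, hvol w hw hwa, hw, hwa ▸ ha⟩ hact

end PeierlsLocal

/-! ### The hypotheses on SATURATED volumes (no territory-closure)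

The expansion is actually run on volumes that are only cell-saturated in the ordinary sites (a
volume mark may keep cells of its territory frozen: at the root every mark is a volume mark and
only the ordinary sites of the conditioning cells are frozen, so that EVERY boundary pair is
admissible and no frozen mark is ever active). The hypotheses of the engine are therefore asked
for all such volumes; the `IsHVol` forms above are their restrictions. -/

section Saturated

/-- **Strict admissibility** of a boundary pair relative to the source region `F`: off the
volume, ordinary sites whose cell is not a source cell agree and are good in both configurations,
and EVERY frozen site is inactive in both. [folklore] -/
def HyperAdmSat (cell : V → CoarseIdx μ) (act : V → Set S) (good : CoarseIdx μ → Set (V → S))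
    (F : Finset (CoarseIdx μ)) (Λ : Finset V) (ζ ζ' : V → S) : Prop :=
  (∀ v, v ∉ Λ → act v = ∅ → cell v ∉ F → ζ v = ζ' v ∧ ζ ∈ good (cell v) ∧ ζ' ∈ good (cell v)) ∧
    ∀ v, v ∉ Λ → ζ v ∉ act v ∧ ζ' v ∉ act v

/-- Strict admissibility is symmetric in the pair. [folklore] -/
theorem HyperAdmSat.symm {cell : V → CoarseIdx μ} {act : V → Set S}
    {good : CoarseIdx μ → Set (V → S)} {F : Finset (CoarseIdx μ)} {Λ : Finset V} {ζ ζ' : V → S}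
    (h : HyperAdmSat cell act good F Λ ζ ζ') : HyperAdmSat cell act good F Λ ζ' ζ :=
  ⟨fun v hv ho hF => ⟨(h.1 v hv ho hF).1.symm, (h.1 v hv ho hF).2.2, (h.1 v hv ho hF).2.1⟩,
    fun v hv => ⟨(h.2 v hv).2, (h.2 v hv).1⟩⟩

/-- Strict admissibility is monotone in the source region. [folklore] -/
theorem HyperAdmSat.mono {cell : V → CoarseIdx μ} {act : V → Set S}
    {good : CoarseIdx μ → Set (V → S)} {F F' : Finset (CoarseIdx μ)} (hFF' : F ⊆ F')
    {Λ : Finset V} {ζ ζ' : V → S} (h : HyperAdmSat cell act good F Λ ζ ζ') :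
    HyperAdmSat cell act good F' Λ ζ ζ' :=
  ⟨fun v hv ho hF => h.1 v hv ho fun hvF => hF (hFF' hvF), h.2⟩

/-- A strictly admissible exterior has no active frozen site at all, in particular none meeting
the volume. [folklore] -/
theorem HyperAdmSat.noFrozenAct_left {cell : V → CoarseIdx μ} {terr : V → Finset (CoarseIdx μ)}
    {act : V → Set S} {good : CoarseIdx μ → Set (V → S)} {F : Finset (CoarseIdx μ)} {Λ : Finset V}
    {ζ ζ' : V → S} (h : HyperAdmSat cell act good F Λ ζ ζ') : NoFrozenAct cell terr act Λ ζ :=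
  fun v hv _ => (h.2 v hv).1

/-- The same for the second member of the pair. [folklore] -/
theorem HyperAdmSat.noFrozenAct_right {cell : V → CoarseIdx μ} {terr : V → Finset (CoarseIdx μ)}
    {act : V → Set S} {good : CoarseIdx μ → Set (V → S)} {F : Finset (CoarseIdx μ)} {Λ : Finset V}
    {ζ ζ' : V → S} (h : HyperAdmSat cell act good F Λ ζ ζ') : NoFrozenAct cell terr act Λ ζ' :=
  fun v hv _ => (h.2 v hv).2

/-- **Hyper-Markov property on saturated volumes**: as `IsHyperMarkovV`, asked for every finite
set of sites cell-saturated in the ordinary sites (volume marks may have frozen cells in their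
territories; their active ones read the ordinary sites of those cells, which premise (a) makes
agree). [cite: Georgii2011, Ch. 8] -/
def IsHyperMarkovSat [MeasurableSpace S] [Fintype V] (cell : V → CoarseIdx μ) (terr : V → Finset (CoarseIdx μ))
    (act : V → Set S) (γ : Specification V S) : Prop :=
  ∀ (Λ : Finset V), (∀ v w, act v = ∅ → act w = ∅ → cell v = cell w → v ∈ Λ → w ∈ Λ) →
    ∀ (ζ ζ' : V → S),
    (∀ v, v ∉ Λ → act v = ∅ → (∃ w ∈ Λ, ∃ c ∈ terr w, cdist c (cell v) ≤ 1) → ζ v = ζ' v) →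
    (∀ v, v ∉ Λ → (∃ w ∈ Λ, act w = ∅ ∧ cell w ∈ terr v) →
      (ζ v ∈ act v ↔ ζ' v ∈ act v) ∧
        (ζ v ∈ act v → ζ v = ζ' v ∧ ∀ w, w ∉ Λ → act w = ∅ → cell w ∈ terr v → ζ w = ζ' w)) →
    ∀ f : (V → S) → ℝ, Measurable f → (∀ σ, 0 ≤ f σ ∧ f σ ≤ 1) →
      ActDependsOn act f {v | v ∈ Λ ∨ ζ v = ζ' v} {v | (ζ v ∈ act v ↔ ζ' v ∈ act v)} →
      ∫ σ, f σ ∂(γ Λ ζ) = ∫ σ, f σ ∂(γ Λ ζ')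

/-- **Good-exterior finite-size condition on saturated volumes** (window `n`, threshold `ε`): as
`IsGoodFSHyperV`, asked for every cell-saturated finite set of sites all of whose territories lie
in the cube. [cite: DobrushinShlosman1985, §2] -/
structure IsGoodFSHyperSat [MeasurableSpace S] [Fintype V] (cell : V → CoarseIdx μ) (terr : V → Finset (CoarseIdx μ))
    (act : V → Set S) (γ : Specification V S) (good : CoarseIdx μ → Set (V → S)) (n : ℕ)
    (ε : ℝ) : Prop where
  /-- goodness of a cell reads only its ordinary sites -/
  good_local : ∀ (c : CoarseIdx μ) (σ τ : V → S),
    (∀ v, act v = ∅ → cell v = c → σ v = τ v) → (σ ∈ good c ↔ τ ∈ good c)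
  /-- goodness events are measurable -/
  good_meas : ∀ c, MeasurableSet (good c)
  /-- the finite-size condition for good exteriors without active frozen marks -/
  fs : ∀ (c : CoarseIdx μ) (Λ : Finset V),
    (∀ v w, act v = ∅ → act w = ∅ → cell v = cell w → v ∈ Λ → w ∈ Λ) →
    (∀ v ∈ Λ, ∀ a ∈ terr v, cdist c a ≤ 2 * n) →
    ∀ ζ ζ' : V → S, (∀ v, act v = ∅ → cdist c (cell v) ≤ 2 * n → ζ v = ζ' v) →
      (∀ c', cdist c c' ≤ 2 * n + 1 → ¬ VolCell cell act Λ c' → ζ ∈ good c' ∧ ζ' ∈ good c') →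
      NoFrozenAct cell terr act Λ ζ → NoFrozenAct cell terr act Λ ζ' →
      ∀ f : (V → S) → ℝ, Measurable f → (∀ σ, 0 ≤ f σ ∧ f σ ≤ 1) →
        DependsOn f {v | act v = ∅ ∧ cell v = c} →
        |∫ σ, f σ ∂(γ Λ ζ) - ∫ σ, f σ ∂(γ Λ ζ')| ≤ ε

/-- **Two-species kernel-uniform Peierls bound on saturated volumes**: as `HyperPeierlsV`, asked
for every cell-saturated finite set of sites. [cite: Georgii2011, §6.2] -/
def HyperPeierlsSat [MeasurableSpace S] [Fintype V] (cell : V → CoarseIdx μ) (terr : V → Finset (CoarseIdx μ))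
    (act : V → Set S) (γ : Specification V S) (good : CoarseIdx μ → Set (V → S)) (q : ℝ)
    (r : V → ℝ) : Prop :=
  ∀ (Λ : Finset V), (∀ v w, act v = ∅ → act w = ∅ → cell v = cell w → v ∈ Λ → w ∈ Λ) →
    ∀ (ζ : V → S), NoFrozenAct cell terr act Λ ζ →
    ∀ (D : Finset (CoarseIdx μ)) (M : Finset V),
      (∀ c ∈ D, ∀ c' : CoarseIdx μ, cdist c c' ≤ 1 → VolCell cell act Λ c' ∨ ζ ∈ good c') →
      M ⊆ Λ →
      γ Λ ζ ({σ | ∀ c ∈ D, σ ∉ good c} ∩ {σ | ∀ v ∈ M, σ v ∈ act v}) ≤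
        ENNReal.ofReal (q ^ D.card * ∏ v ∈ M, r v)

/-- Saturation in the ordinary sites is preserved by restriction to the sites with territory in a
cell set (ordinary sites having singleton territories). [folklore] -/
theorem sat_filter_terr_subset {cell : V → CoarseIdx μ} {terr : V → Finset (CoarseIdx μ)}
    {act : V → Set S} {Λ : Finset V}
    (hsat : ∀ v w, act v = ∅ → act w = ∅ → cell v = cell w → v ∈ Λ → w ∈ Λ)
    (hord : ∀ v, act v = ∅ → terr v = {cell v}) (B : Finset (CoarseIdx μ)) :
    ∀ v w, act v = ∅ → act w = ∅ → cell v = cell w →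
      v ∈ Λ.filter (fun v => terr v ⊆ B) → w ∈ Λ.filter (fun v => terr v ⊆ B) := by
  intro v w hv hw hvw hvΛ
  rw [Finset.mem_filter] at hvΛ ⊢
  refine ⟨hsat v w hv hw hvw hvΛ.1, ?_⟩
  rw [hord w hw, Finset.singleton_subset_iff, ← hvw]
  exact hvΛ.2 (by rw [hord v hv]; exact Finset.mem_singleton_self _)

/-- Saturation is preserved by removing arbitrary non-ordinary sites. [folklore] -/
theorem sat_sdiff_marks {cell : V → CoarseIdx μ} {act : V → Set S} {Λ : Finset V}
    (hsat : ∀ v w, act v = ∅ → act w = ∅ → cell v = cell w → v ∈ Λ → w ∈ Λ) (M : Finset V)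
    (hM : ∀ v ∈ M, act v ≠ ∅) :
    ∀ v w, act v = ∅ → act w = ∅ → cell v = cell w → v ∈ Λ \ M → w ∈ Λ \ M := by
  intro v w hv hw hvw hvΛ
  rw [Finset.mem_sdiff] at hvΛ ⊢
  exact ⟨hsat v w hv hw hvw hvΛ.1, fun hwM => hM w hwM hw⟩

/-- Saturation is preserved by removing the ordinary sites of a cell. [folklore] -/
theorem sat_removeCell {cell : V → CoarseIdx μ} {act : V → Set S} {Λ : Finset V}
    (hsat : ∀ v w, act v = ∅ → act w = ∅ → cell v = cell w → v ∈ Λ → w ∈ Λ) (y : CoarseIdx μ) :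
    ∀ v w, act v = ∅ → act w = ∅ → cell v = cell w →
      v ∈ Λ.filter (fun v => ¬ (act v = ∅ ∧ cell v = y)) →
      w ∈ Λ.filter (fun v => ¬ (act v = ∅ ∧ cell v = y)) := by
  intro v w hv hw hvw hvΛ
  rw [Finset.mem_filter] at hvΛ ⊢
  exact ⟨hsat v w hv hw hvw hvΛ.1, fun h => hvΛ.2 ⟨hv, hvw.trans h.2⟩⟩

/-- The root volume — all sites except the ordinary sites of the cells of `Δ` — is saturated.
[folklore] -/
theorem sat_rootVolume [Fintype V] {cell : V → CoarseIdx μ} {act : V → Set S}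
    (Δ : Finset (CoarseIdx μ)) :
    ∀ v w, act v = ∅ → act w = ∅ → cell v = cell w →
      v ∈ Finset.univ.filter (fun v : V => ¬ (act v = ∅ ∧ cell v ∈ Δ)) →
      w ∈ Finset.univ.filter (fun v : V => ¬ (act v = ∅ ∧ cell v ∈ Δ)) := by
  intro v w hv _ hvw hvΛ
  simp only [Finset.mem_filter, Finset.mem_univ, true_and] at hvΛ ⊢
  exact fun h => hvΛ ⟨hv, hvw ▸ h.2⟩

end Saturated

end Literature.Probability.LatticeModels
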